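import Mathlib

/-!
# Slope arithmetic of the `T* × ℤ_d` row read on the exceptional Klein bottle (solo notes, Part I-ter 5.12)

Peripheral coordinates of the order-2 exceptional fibre `E₂` of `T*\S³ = (-1; (2,1),(3,1),(3,1))`
(additively, in the basis `(s, h)` = section loop, regular fibre):
`μ_E = 2s + h`, the invariant parallel `λ₁ = s + h`, and the other longitudes
`λ_m = λ₁ + ((m-1)/2) μ_E` (`m` odd; `m = 2j+1` gives `λ_m = (1+2j) s + (1+j) h`).
The row member `k` (closed fibre `(-1+k; (2,1),(3,1),(3,1))`, `π₁ = T* × ℤ_d`, `d = |6k+1|`)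
is the filling of `E₂` along `σ(k) = 2s + (2k+1)h = μ_E + 2k·h`.

* `SoloInformed_trow_slope` : `σ(k) = (1 - 2k(2j+1))·μ_E + 4k·λ_{2j+1}` (coordinatewise), so the
  member `k` is a Klein surgery of multiplicity `|1 - 2k·m|` and auxiliary multiplicity `4k` with
  respect to the longitude `λ_m`.
* `SoloInformed_trow_multiplicity_one` : if that multiplicity is `1` and the longitude is
  ADMISSIBLE (`m ≡ 1 (mod 4)`, the collars that are trivial in the Klein-bottle group `ℤ₂`), then
  `k = 0` (the trivial member) or `(k, m) = (1, 1)`: the `d = 7` member in the direction `λ₁`,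
  with even auxiliary multiplicity `4` — the unique configuration to which the multiplicity-one
  (Klein–Iwase) regluing theorem applies.
* `SoloInformed_trow_d_coprime_six` : `d = |6k+1|` is prime to `6`.

Only this arithmetic is kernel-checked here; the topology (the surgery description, the
compressing disc, Klein–Iwase) lives in the solo notebook (CLAIMS C993–C994).
-/

namespace Summit.SmoothPoincare4.SmoothPoincare4.Theorems

/-- `σ(k) = 2s + (2k+1)h` equals `(1 - 2k(2j+1))·μ_E + 4k·λ_{2j+1}` with `μ_E = (2,1)`,
`λ_{2j+1} = (1+2j, 1+j)` in the basis `(s,h)`: both coordinates. -/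
theorem SoloInformed_trow_slope (k j : ℤ) :
    (1 - 2 * k * (2 * j + 1)) * 2 + 4 * k * (1 + 2 * j) = 2 ∧
    (1 - 2 * k * (2 * j + 1)) * 1 + 4 * k * (1 + j) = 2 * k + 1 := by
  constructor <;> ring

/-- Multiplicity one with respect to an admissible longitude happens only for the trivial member
`k = 0` or for `(k, m) = (1, 1)` (`m = 2j+1`, admissible means `m % 4 = 1`). -/
theorem SoloInformed_trow_multiplicity_one (k j : ℤ)
    (hadm : (2 * j + 1) % 4 = 1) (h : |1 - 2 * k * (2 * j + 1)| = 1) :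
    k = 0 ∨ (k = 1 ∧ j = 0) := by
  rcases (abs_eq (by norm_num : (0:ℤ) ≤ 1)).mp h with h1 | h1
  · -- 1 - 2k(2j+1) = 1, so k(2j+1) = 0 and 2j+1 ≠ 0
    left
    have hk : k * (2 * j + 1) = 0 := by linarith
    rcases mul_eq_zero.mp hk with hk0 | hj0
    · exact hk0
    · omega
  · -- 1 - 2k(2j+1) = -1, so k(2j+1) = 1: units of ℤ
    right
    have hk : k * (2 * j + 1) = 1 := by linarith
    rcases Int.eq_one_or_neg_one_of_mul_eq_one' hk with ⟨hk1, hm1⟩ | ⟨hk1, hm1⟩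
    · exact ⟨hk1, by omega⟩
    · exfalso
      omega

/-- `d = |6k+1|` is prime to `6`. -/
theorem SoloInformed_trow_d_coprime_six (k : ℤ) : IsCoprime (6 * k + 1) 6 := by
  refine ⟨1, -k, ?_⟩
  ring

end Summit.SmoothPoincare4.SmoothPoincare4.Theorems
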